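import Literature.AlgebraicGeometry.Hu2025.Statements.S04ModelV.R103bDescendants

/-!
# Hu 2025 (arXiv:2507.21400v1, Part I), §4.2 — further items of PARTITION-HU row 103: Cor. 4.10 ‹chunk Cor. 4.9› [OPT],
# the claim after Ex. 4.14 «a ℘-binomial does not admit any non-zero root parent» (C23L47), and the OURS reading of
# Lem. 4.8 with its platform hypotheses explicit (`Lem4_8_ours`);
# file c of row 103 (`S04ModelV/R103cClaims.lean`), STATEMENTS-FIRST (LADDER-RESOLUTION rung M-Hu-min, D-0089)

Text of record: chunk p0022 l.136–149 and p0023 l.47–48 of `paper:arxiv-2507.21400`; PDF cross-check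
`lit/res-lit-6/hu25/text/hu25_p049.txt` L012–L017 and `hu25_p050.txt` L027. Typer of record res-type-042 (row 103),
every locator read on the chunk and the PDF text (T9). NOTHING from the preprint is asserted: `def … : Prop` CANDIDATE
STATEMENTS tagged `[claim: Hu2025, status: under-review]`; no proofs, no `sorry`, no `instance`, no notation.
HONEST CEILING (PARTITION-HU header): Part I as printed claims resolution of singularity TYPES; the summit-type claim
rests on the UNPOSTED Part II. AI typing/adjudication is weaker than expert review.

Carriers: row 103 files a/b (`ModelRing`, `rhoVar`, `img`, `monoR`, `varphi`, `kerMH`, `wpBinomial`, `HasNoCommonFactor`,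
`IsWpIrreducible`, `IsRootParentOf` / `IsRootParentOfR2`); the platform parameters `rk : 𝔗 → ℕ` (rank of a primary
relation, I-PL `rkPrimary`) and `head : 𝔗 → T` (leading term `s_F`, I-GOV `head`) are explicit, as in `Lem4_8`.
-/

noncomputable section

namespace Literature.AlgebraicGeometry.Hu2025.Statements.S04ModelV

open MvPolynomial

universe u v w x

variable {k : Type u} [CommRing k] {σ : Type v} {T : Type w} {𝔗 : Type x}
variable (rel : T → 𝔗) (mono : T → (σ →₀ ℕ))

/-- **Hu 2025, Cor. 4.10 ‹chunk Corollary 4.9›** (chunk p0022 l.136–149; PDF p.49 L012–L017), verbatim: «Consider a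
nonzero binomial `m − m′ ∈ ker^mh φ_[k]`, having no common factor. Suppose `m − m′` is ℘-irreducible. Then `φ(m)`
`(= φ(m′))` is not divisible by any rank-1 variable `x_abc`. Moreover, it is impossible to have `x_(123,iuv) ∣ m` and
`x_iuv ∣ m′` nor to have `x_(123,iuv) ∣ m′` and `x_iuv ∣ m`, for any rank-0 variable `x_iuv`. Proof. It follows by
combining Lemmas 4.8 and 4.9.» Typed on the exponent vectors `a, a′` of `m, m′`; «rank-1 variable `x_abc`» = the chart
monomial `x̄_{s_F} = img mono (head F)` of a relation `F` with `rk F = 1` (divisibility of `φ(m)` in `R_0`); «rank-0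
variable `x_iuv`» / «`x_(123,iuv)`» = `x̄_{s_F}` (exponent `monoR mono (head F)`) / `rhoVar (head F)` for `rk F = 0`.
[OPT] item of PARTITION-HU row 103; not read by any joint. [claim: Hu2025, status: under-review]
STATUS: candidate statement under adjudication (D-0012/D-0089); not asserted. -/
def Cor4_10 [DecidableEq 𝔗] (rk : 𝔗 → ℕ) (head : 𝔗 → T) (Φ : Set 𝔗) : Prop :=
  ∀ a a' : σ ⊕ T →₀ ℕ,
    (monomial a (1 : k) - monomial a' 1 : ModelRing σ T k) ≠ 0 →
    (monomial a (1 : k) - monomial a' 1 : ModelRing σ T k) ∈ kerMH (k := k) rel mono Φ →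
    HasNoCommonFactor (σ := σ) (T := T) a a' →
    IsWpIrreducible (k := k) rel mono Φ a a' →
    (∀ F : 𝔗, rk F = 1 → ¬ (img (k := k) mono (head F) ∣ varphi (k := k) mono (monomial a 1))) ∧
    (∀ F : 𝔗, rk F = 0 →
      ¬ (Finsupp.single (Sum.inr (head F)) 1 ≤ a ∧ monoR mono (head F) ≤ a') ∧
      ¬ (Finsupp.single (Sum.inr (head F)) 1 ≤ a' ∧ monoR mono (head F) ≤ a))

/-- **Hu 2025, in-text claim after Ex. 4.14 ‹chunk Ex. 4.13›** (chunk p0023 l.47–48; PDF p.50 L027), verbatim: «It is not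
hard to see that a ℘-binomial does not admit any non-zero root parent.» — reading R1 (res-type-044's parent relation):
every root parent (Def. 4.11, `IsRootParentOf`) of a member of `B^℘_[k]` is `0`. Typed claim.
[claim: Hu2025, status: under-review]
STATUS: candidate statement under adjudication (D-0012/D-0089); not asserted. -/
def C23L47 [DecidableEq 𝔗] (Φ : Set 𝔗) : Prop :=
  ∀ b ∈ wpBinomials (k := k) (σ := σ) rel mono Φ, ∀ f : ModelRing σ T k,
    IsRootParentOf (k := k) rel mono f b → f = 0

/-- **The same claim in reading R2** (term-wise parents in `R_[k]`, `IsRootParentOfR2 Φ`). Typed claim.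
[claim: Hu2025, status: under-review]
STATUS: candidate statement under adjudication (D-0012/D-0089); not asserted. -/
def C23L47_R2 [DecidableEq 𝔗] (Φ : Set 𝔗) : Prop :=
  ∀ b ∈ wpBinomials (k := k) (σ := σ) rel mono Φ, ∀ f : ModelRing σ T k,
    IsRootParentOfR2 (k := k) rel mono Φ f b → f = 0

/-- **Hu 2025, Lem. 4.8 ‹chunk Lemma 4.7› — OURS reading with the PLATFORM FACTS its printed proof invokes made explicit
hypotheses** (chunk p0022 l.74–106; proof l.92–93 «because `x_(123,abc)` is the unique ϱ-variable such that its `φ`-image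
is dividable by `x_abc`»; PDF p.48 L013–L032): for some assignment `u : 𝔗 → σ` of a ϖ-variable to each relation,
(hhead) the leading term `head F` is a term of `F`; (H1) for rank-one `F` the chart monomial of `head F` is the single
variable `x_{u F}` (`x̄_{s_F} = x_abc`); (H2) `u F` occurs in the chart monomial of no other term — THEN the generic
`Lem4_8 rel mono rk head Φ`. Sibling of the AS-PRINTED generic `Lem4_8` (file b); labelled OURS (PARTITION-HU §6 (e)):
the hypotheses are read off the proof, not the statement. [claim: Hu2025, status: under-review]
STATUS: candidate statement under adjudication (D-0012/D-0089); not asserted. -/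
def Lem4_8_ours [DecidableEq 𝔗] (rk : 𝔗 → ℕ) (head : 𝔗 → T) (Φ : Set 𝔗) : Prop :=
  ∀ u : 𝔗 → σ, (∀ F : 𝔗, rel (head F) = F) →
    (∀ F : 𝔗, rk F = 1 → mono (head F) = Finsupp.single (u F) 1) →
    (∀ F : 𝔗, rk F = 1 → ∀ t : T, t ≠ head F → u F ∉ (mono t).support) →
    Lem4_8 (k := k) rel mono rk head Φ

end Literature.AlgebraicGeometry.Hu2025.Statements.S04ModelV

end
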